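import Summits.BirchSwinnertonDyer.BirchSwinnertonDyer.Theorems.ClassRecordThreeEulerHalvesAtThreeWalkSupplyAtThreeSharp
import Summits.BirchSwinnertonDyer.BirchSwinnertonDyer.Theorems.ClassRecordThreeEulerHalvesAtThreeWalkFamiliesOrderedBase
import Summits.BirchSwinnertonDyer.BirchSwinnertonDyer.Theorems.ClassRecordThreeEulerHalvesAtThreeWalkFinite
import Summits.BirchSwinnertonDyer.BirchSwinnertonDyer.Theorems.ClassRecordThreeEulerHalvesAtThreeWalkTildeSign
import Summits.BirchSwinnertonDyer.BirchSwinnertonDyer.Theorems.ClassRecordThreeEulerHalvesAtThreeWalkOrders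
import Summits.BirchSwinnertonDyer.BirchSwinnertonDyer.Theorems.ClassRecordThreeEulerHalvesAtThreeKolyvaginRedefinition
import Summits.BirchSwinnertonDyer.BirchSwinnertonDyer.Theorems.ClassRecordThreeEulerHalvesAtThreeWalkCompatData
import Summits.BirchSwinnertonDyer.BirchSwinnertonDyer.Theorems.ClassRecordThreeEulerHalvesAtThreeWalkGross53
import Summits.BirchSwinnertonDyer.BirchSwinnertonDyer.Theorems.ClassRecordThreeEulerHalvesAtThreeWalkSupplyTrivia
import Literature.NumberTheory.QuadraticFields.HeegnerCondition
import HarnessLib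

/-!
# `stub_jetchevMaxHLAtThree` ⟸ {SEVEN print facts} + {the per-frame SELMER supply}: every conjunct left in
# the supply is a statement about Selmer structures on `H¹(K, E[3^k])` — the sign bookkeeping (`eb`, `ε`),
# Gross Prop. 5.3 (`h53`), McCallum Prop. 4.7 (`h47`) and the sign half of Prop. 4.9 are all gone from it
# (cell `bsd-stepL`, seat `bsd-stepL-tam3-p1`, helper toward item 19109 `EulerHalvesAtThree`)

HONEST FRAMING. Nothing here proves BSD, J₃ or the divisibility of any Heegner point; the registered
stub `stub_jetchevMaxHLAtThree` is NOT discharged — `hsupply` below is a hypothesis nothing in the tree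
supplies yet; no item closes; 0 classes move (T7); `--supports stmt-BirchSwinnertonDyer-19109` (helper).
WHAT THIS FILE DOES. `jetchevMaxHLAtThree_of_facts_of_selmerSupply : h52 → h44 → h53 → hD36 → hrec → hGZ →
hmod → hsupply → ‹stub VERBATIM›`. Compared with `jetchevMaxHLAtThree_of_facts_of_baseSupply` (p514388):
(i) one more PRINT fact at the top, `h53 : ∀ W K, heegnerPointOfConductor_conj_sub_neg_rootNumber_smul W K`
(Gross 1991 Prop. 5.3 = Darmon 2004 Prop. 3.11 at conductor `n`, the named fact of `…WalkGross53`, whose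
conductor-one sibling `heegnerPoint_conj_add_rootNumber_smul` is PROVED in the tree); (ii) the sign
`ε := −w(E)` (`W.rootNumber`) and a sign function `eb` with `eb(mℓ) = ¬eb(m)`,
`(eb m ? 1 : −1) = ε(−1)^{#primes(m)}` (`JET.Walk.exists_signFunction`) are constructed inside and HANDED
to the supplier together with the data system `D` (`∀ D, D n = d → ∀ ε ∈ {±1}, ∀ eb, … → ∃ 𝒯 𝒮 Qcar C', …`);
(iii) the conjuncts heb, hebε, **h53** are absent. What is left in `hsupply`, all per level, pointwise in
the data and about Selmer structures only: hS (`𝒮 ≤` Kummer at the carrier) · hQcar (carrier above `N`)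
· **hdisj** ([J] §4.2: `𝒯_λ ∩ Kum_λ = 0` at Kolyvagin `λ`, `ℓ ∤ n`) · **hPT** (Thm 5.1 ∕ Lemma 5.2 (iii)
per sign: `#loc_λ((H_{𝓕(s)^λ})^±) = 3^k`; `n ∣ s`, `ℓ` above `s`) · **hselmer** (Prop. 4.5–4.6: the classes
of the `3^u`-th roots of `P_s` lie in `H_{𝓕(s)}`) · hC (`C'(m) ≤` the `∓`-part) · **hdual_q** (Thm 5.1 at
the carrier + (δ); `n ∣ s`) · **hsel0** (Prop. 4.6 ∕ 4.9: `c_k(sℓ) ∈ H_{𝓕₀(s)^λ}`; `n ∣ s`, `ℓ` above `s`)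
· **hdual_ℓ** (Lemma 5.2 (iii) at λ for 𝓕₀; `n ∣ s`, `ℓ` above `s`). Discharged inside: `hfin`
(`JET.Walk.hfin_of_kummer`), `hordκ` (`Koly.hordκ_of_admissibleData`), `hκt`
(`Koly.hκt_of_selmerMembership`, with `hdivfin := divOrd_ne_top_of_levelIndex_eq_top`), `h47`
(`Koly.exists_data_h47Base_of_prop44` from `h44`), `h49` (`Koly.h49_of_selmerMembership`), `h53`'s shape
(`Koly.h53_of_heegnerPointReflection`), `τ`, `ρ̄` onto, `W` non-CM, the 3-adic tower, `k ≥ 1`,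
admissibility, `(N, d_K) = 1`, `d_K < −4` from the frame.
References (locators only; no cited FACT declared here): [cite: Jetchev2008, Thm. 1.4 (p. 812), §3.1,
Prop. 4.5–4.9, Thm. 5.1, Lemma 5.2, Lemma 6.1, Thm. 6.3, Prop. 6.4, Proof of Thm. 1.4 (pp. 816–825)]
[cite: McCallumLMS1991, §3 Cor. 3.2, §4 Prop. 4.4, Cor. 4.5, §5 Prop. 5.2] [cite: GrossLMS1991, §3–§5,
(5.2), Prop. 5.3, Prop. 5.4] [cite: Darmon2004, Prop. 3.11] [cite: WZhang2014, Notations (xii)]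
[cite: SilvermanAEC2009, Lemma X.4.3, Cor. X.4.4] [cite: Wuthrich2014, Lemma 20]. Design: one theorem, no
definitions; `K : Type`. Axioms: `propext`, `Classical.choice`, `Quot.sound`.
-/

set_option autoImplicit false

noncomputable section

open scoped Classical NumberField

namespace Summit.BirchSwinnertonDyer.Rank1Residual.X11b.Three.Koly

open WeierstrassCurve IsDedekindDomain NumberField Field Literature.NumberTheory.EllipticCurves
  Literature.NumberTheory.EllipticCurves.ModularForms Literature.NumberTheory.EllipticCurves.Jetchev2008
  Literature.NumberTheory.EllipticCurves.KolyvaginCocycle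
  Literature.NumberTheory.EllipticCurves.Rank1Residual Literature.NumberTheory.GaloisRepresentations
  Literature.NumberTheory.GaloisRepresentations.DiscreteGaloisModule
  Summit.BirchSwinnertonDyer.Rank1Residual.X11b Summit.BirchSwinnertonDyer.Rank1Residual.JET

/-- **`stub_jetchevMaxHLAtThree` VERBATIM ⟸ seven print facts + the per-frame Selmer supply** — the data
system, the sign `ε = −w(E)` and the sign function are handed to the supplier; `h47`, `h53`, the signs
of `κ̃` and of Prop. 4.9 are discharged inside; see the module docstring. [cite: Jetchev2008, Thm. 1.4
(p. 812), Proof of Thm. 1.4 (p. 825)] [cite: McCallumLMS1991, §4 Prop. 4.4, §5 Prop. 5.2]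
[cite: GrossLMS1991, Prop. 5.3] [cite: Darmon2004, Prop. 3.11] -/
theorem jetchevMaxHLAtThree_of_facts_of_selmerSupply
    (h52 : McCallum1991.prop52_exists_conductor_kolyvaginClass_order_eq)
    (h44 : McCallum1991.prop44_localOrder_kolyvaginClass_mul_eq)
    (h53 : ∀ (W : WeierstrassCurve ℚ) (K : Type) [Field K] [NumberField K],
      heegnerPointOfConductor_conj_sub_neg_rootNumber_smul W K)
    (hD36 : ∀ (N : ℕ) [NeZero N] (W : WeierstrassCurve ℚ) (K : Type) [Field K] [NumberField K],
      phi_heegnerTau_mem_singularModuliField N W K)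
    (hrec : ∀ (N : ℕ) [NeZero N] (W : WeierstrassCurve ℚ) (K : Type) [Field K] [NumberField K],
      heegnerPointOfConductor_one_galoisConj N W K)
    (hGZ : ∀ (N : ℕ) [NeZero N] (W : WeierstrassCurve ℚ) (K : Type) [Field K] [NumberField K],
      gross_zagier N W K)
    (hmod : hasEntireLFunction_rat)
    (hsupply : ∀ (W : WeierstrassCurve ℚ) [W.IsElliptic] [W.IsGloballyMinimal] [NeZero (W.conductorNorm ℤ)]
      (K : Type) [Field K] [NumberField K]
      (Dt : ModularParametrizationData W (W.conductorNorm ℤ)) (β : ℤ) (ι : K →+* ℂ),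
      W.analyticRank = 1 → W.HasMultiplicativeReductionAtPrime 3 → Surj W 3 →
      IsImaginaryQuadratic K → SatisfiesHeegnerHypothesis (W.conductorNorm ℤ) K →
      Odd (NumberField.discr K) → (W.quadraticTwist (NumberField.discr K : ℚ)).entireLFunction 1 ≠ 0 →
      (4 * (W.conductorNorm ℤ : ℤ)) ∣ β ^ 2 - NumberField.discr K → ¬ (3 : ℤ) ∣ Dt.c →
      ∀ (τ : K ≃ₐ[ℚ] K), τ ≠ 1 → ∀ (v : HeightOneSpectrum (𝓞 ℚ)) (k : ℕ), 1 ≤ k →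
        padicValNat 3 (W.tamagawaNumberAt v) ≤ k →
      ∀ (n : ℕ) (d : KolyvaginHeegnerData Dt β ι n) (hn : Squarefree n ∧ ∀ q ∈ n.primeFactors,
        Zhang2014.IsKolyvaginPrime (W.conductorNorm ℤ) W K 3 q ∧ k ≤ Zhang2014.kolyvaginIndex W 3 q),
      ∀ (D : ∀ s : {m : ℕ // Squarefree m ∧ ∀ q ∈ m.primeFactors,
        Zhang2014.IsKolyvaginPrime (W.conductorNorm ℤ) W K 3 q ∧ k ≤ Zhang2014.kolyvaginIndex W 3 q},
          KolyvaginHeegnerData Dt β ι s.1), D ⟨n, hn⟩ = d →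
      ∀ (ε : ℤ), (ε = 1 ∨ ε = -1) → ∀ (eb : ℕ → Bool),
        (∀ (m ℓ : ℕ), ℓ.Prime → ¬ ℓ ∣ m → eb (m * ℓ) = !eb m) →
        (∀ m, (if eb m then (1 : ℤ) else -1) = ε * (-1) ^ m.primeFactors.card) →
      ∃ (𝒯 𝒮 : SelmerStructure ((W.baseChange K).torsionGaloisModule ((3 ^ k : ℕ) : ℤ)))
        (Qcar : Finset (HeightOneSpectrum (𝓞 K)))
        (C' : ℕ → AddSubgroup (galoisCohomology ((W.baseChange K).torsionGaloisModule ((3 ^ k : ℕ) : ℤ)) 1)),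
        (∀ v, 𝒮 v ≤ (W.baseChange K).kummerSelmerStructure ((3 ^ k : ℕ) : ℤ) v) ∧
        (∀ v ∈ Qcar, ((W.conductorNorm ℤ : ℕ) : 𝓞 K) ∈ v.asIdeal) ∧
        (∀ (ℓ : ℕ), Zhang2014.IsKolyvaginPrime (W.conductorNorm ℤ) W K 3 ℓ →
      k ≤ Zhang2014.kolyvaginIndex W 3 ℓ → ¬ ℓ ∣ n → ∀ v : HeightOneSpectrum (𝓞 K), (ℓ : 𝓞 K) ∈ v.asIdeal →
      Disjoint ((W.baseChange K).kummerSelmerStructure ((3 ^ k : ℕ) : ℤ) (Sum.inr v)) (𝒯 (Sum.inr v))) ∧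
        (∀ (s : {m : ℕ // Squarefree m ∧ ∀ q ∈ m.primeFactors,
        Zhang2014.IsKolyvaginPrime (W.conductorNorm ℤ) W K 3 q ∧ k ≤ Zhang2014.kolyvaginIndex W 3 q})
      (ℓ : ℕ), Zhang2014.IsKolyvaginPrime (W.conductorNorm ℤ) W K 3 ℓ →
      k ≤ Zhang2014.kolyvaginIndex W 3 ℓ → ¬ ℓ ∣ s.1 → (∀ q ∈ s.1.primeFactors, q < ℓ) → n ∣ s.1 →
      ∀ v : HeightOneSpectrum (𝓞 K), (ℓ : 𝓞 K) ∈ v.asIdeal → ∀ b : Bool,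
      Nat.card ((signPart W K τ ((3 ^ k : ℕ) : ℤ) (if b then 1 else -1)
          ((selmerF W ((3 ^ k : ℕ) : ℤ) 𝒯 (placesDividing K s.1)).relaxedAt {v}).selmerGroup).map
        (galoisCohomology.localization ((W.baseChange K).torsionGaloisModule ((3 ^ k : ℕ) : ℤ))
          (Sum.inr v) 1)) = 3 ^ k) ∧
        (∀ s (u : ℕ) (Q : (W.baseChange (ringClassField K ι s.1)).toAffine.Point)
      (hAk : IsAdmissible (absoluteGaloisGroup K) (D s).pointsSubgroup ((3 ^ k : ℕ) : ℤ))
      (hQ : (D s).toGeomPoints Q ∈ invPoints (absoluteGaloisGroup K) (D s).pointsSubgroup ((3 ^ k : ℕ) : ℤ)),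
      ((3 ^ u : ℕ) : ℤ) • Q = (D s).derivedPoint →
      (¬ ∃ Q' : (W.baseChange (ringClassField K ι s.1)).toAffine.Point,
        ((3 ^ (u + 1) : ℕ) : ℤ) • Q' = (D s).derivedPoint) →
      ((u + k : ℕ) : ℕ∞) ≤ Zhang2014.levelIndex W 3 s.1 →
      (kolyvaginClass (W.baseChange K) ((3 ^ k : ℕ) : ℤ)
        ((W.baseChange K).zsmul_geomPoints_surjective_of_charZero
          (by exact_mod_cast pow_ne_zero k Nat.prime_three.ne_zero)) hAk ((D s).toGeomPoints Q) hQ :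
          galoisCohomology ((W.baseChange K).torsionGaloisModule ((3 ^ k : ℕ) : ℤ)) 1) ∈
        (selmerF W ((3 ^ k : ℕ) : ℤ) 𝒯 (placesDividing K s.1)).selmerGroup) ∧
        (∀ m, C' m ≤ signPart W K τ ((3 ^ k : ℕ) : ℤ) (if !eb m then 1 else -1) ⊤) ∧
        (∀ s : {m : ℕ // Squarefree m ∧ ∀ q ∈ m.primeFactors,
        Zhang2014.IsKolyvaginPrime (W.conductorNorm ℤ) W K 3 q ∧ k ≤ Zhang2014.kolyvaginIndex W 3 q},
      n ∣ s.1 → ∃ (Qg Qg' : Type) (_ : AddCommGroup Qg) (_ : AddCommGroup Qg') (_ : Finite Qg')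
        (locq : signPart W K τ ((3 ^ k : ℕ) : ℤ) (if !eb s.1 then 1 else -1)
            (selmerF W ((3 ^ k : ℕ) : ℤ) 𝒯 (placesDividing K s.1)).selmerGroup →+ Qg)
        (locq' : C' s.1 →+ Qg'),
        (∀ x : C' s.1, locq' x = 0 ↔
          (x : galoisCohomology ((W.baseChange K).torsionGaloisModule ((3 ^ k : ℕ) : ℤ)) 1) ∈
            signPart W K τ ((3 ^ k : ℕ) : ℤ) (if !eb s.1 then 1 else -1)
              (selmerF W ((3 ^ k : ℕ) : ℤ) 𝒯 (placesDividing K s.1)).selmerGroup) ∧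
        Nat.card locq.range * Nat.card locq'.range = Nat.card Qg' ∧ IsAddCyclic Qg' ∧
        Nat.card Qg' = 3 ^ padicValNat 3 (W.tamagawaNumberAt v)) ∧
        (∀ (s s' : {m : ℕ // Squarefree m ∧ ∀ q ∈ m.primeFactors,
        Zhang2014.IsKolyvaginPrime (W.conductorNorm ℤ) W K 3 q ∧ k ≤ Zhang2014.kolyvaginIndex W 3 q})
      (ℓ : ℕ), ℓ.Prime → ¬ ℓ ∣ s.1 → s'.1 = s.1 * ℓ → (∀ q ∈ s.1.primeFactors, q < ℓ) → n ∣ s.1 →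
      ∀ v : HeightOneSpectrum (𝓞 K), (ℓ : 𝓞 K) ∈ v.asIdeal →
      ((D s').kolyvaginClass Nat.prime_three k :
          galoisCohomology ((W.baseChange K).torsionGaloisModule ((3 ^ k : ℕ) : ℤ)) 1) ∈
        (((selmerF0 W ((3 ^ k : ℕ) : ℤ) 𝒯 𝒮 (placesDividing K s.1) Qcar).relaxedAt {v}).selmerGroup)) ∧
        (∀ (s : {m : ℕ // Squarefree m ∧ ∀ q ∈ m.primeFactors,
        Zhang2014.IsKolyvaginPrime (W.conductorNorm ℤ) W K 3 q ∧ k ≤ Zhang2014.kolyvaginIndex W 3 q})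
      (ℓ : ℕ), Zhang2014.IsKolyvaginPrime (W.conductorNorm ℤ) W K 3 ℓ →
      k ≤ Zhang2014.kolyvaginIndex W 3 ℓ → ¬ ℓ ∣ s.1 → (∀ q ∈ s.1.primeFactors, q < ℓ) → n ∣ s.1 →
      ∀ v : HeightOneSpectrum (𝓞 K), (ℓ : 𝓞 K) ∈ v.asIdeal →
      ∃ (Sg : Type) (_ : AddCommGroup Sg)
        (sing : signPart W K τ ((3 ^ k : ℕ) : ℤ) (if !eb s.1 then 1 else -1)
            (((selmerF0 W ((3 ^ k : ℕ) : ℤ) 𝒯 𝒮 (placesDividing K s.1) Qcar).relaxedAt {v}).selmerGroup)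
          →+ Sg),
        (∀ x, sing x = 0 ↔
          (x : galoisCohomology ((W.baseChange K).torsionGaloisModule ((3 ^ k : ℕ) : ℤ)) 1) ∈
            signPart W K τ ((3 ^ k : ℕ) : ℤ) (if !eb s.1 then 1 else -1)
              ((selmerF0 W ((3 ^ k : ℕ) : ℤ) 𝒯 𝒮 (placesDividing K s.1) Qcar).selmerGroup)) ∧
        Nat.card sing.range *
          Nat.card ((C' s.1).map (galoisCohomology.localization
            ((W.baseChange K).torsionGaloisModule ((3 ^ k : ℕ) : ℤ)) (Sum.inr v) 1)) = 3 ^ k)) :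
    ∀ (W : WeierstrassCurve ℚ) [W.IsElliptic] [W.IsGloballyMinimal] [NeZero (W.conductorNorm ℤ)]
      (K : Type) [Field K] [NumberField K]
      (Dt : ModularParametrizationData W (W.conductorNorm ℤ)) (β : ℤ) (ι : K →+* ℂ),
      W.analyticRank = 1 → W.HasMultiplicativeReductionAtPrime 3 → Surj W 3 →
      IsImaginaryQuadratic K → SatisfiesHeegnerHypothesis (W.conductorNorm ℤ) K →
      Odd (NumberField.discr K) → (W.quadraticTwist (NumberField.discr K : ℚ)).entireLFunction 1 ≠ 0 →
      (4 * (W.conductorNorm ℤ : ℤ)) ∣ β ^ 2 - NumberField.discr K → ¬ (3 : ℤ) ∣ Dt.c →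
      ∀ (v : HeightOneSpectrum (𝓞 ℚ)) (s : ℕ), s ≤ padicValNat 3 (W.tamagawaNumberAt v) →
        ∀ (n : ℕ) (d : KolyvaginHeegnerData Dt β ι n), Squarefree n →
          (∀ ℓ ∈ n.primeFactors, Zhang2014.IsKolyvaginPrime (W.conductorNorm ℤ) W K 3 ℓ ∧
            s ≤ Zhang2014.kolyvaginIndex W 3 ℓ) → PDiv d 3 s := by
  refine jetchevMaxHLAtThree_of_facts_of_perLevel h52 hD36 hrec hGZ hmod ?_
  intro W _ _ _ K _ _ Dt β ι hr hmult hρ hK hHN hodd hLt hβ hc3 v k n d hsq hkol h1 h2 h3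
  -- `k ≥ 1` and the admissibility of `n` at level `k`
  have hk : 1 ≤ k := by
    rcases Nat.eq_zero_or_pos k with rfl | hk
    · exact absurd h1 (by simp)
    · exact hk
  have hkM : (k : ℕ∞) ≤ Zhang2014.levelIndex W 3 n := le_trans le_self_add h3
  have hn : Squarefree n ∧ ∀ q ∈ n.primeFactors,
      Zhang2014.IsKolyvaginPrime (W.conductorNorm ℤ) W K 3 q ∧ k ≤ Zhang2014.kolyvaginIndex W 3 q :=
    ⟨hsq, fun q hq ↦ ⟨hkol q hq, Zhang2014.natCast_le_levelIndex_iff.mp hkM q hq⟩⟩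
  -- frame facts: complex conjugation, `(N, d_K) = 1`, `d_K < -4`
  obtain ⟨τ, hτ⟩ := exists_algEquiv_ne_one_of_isImaginaryQuadratic K hK
  have hND : IsCoprime ((W.conductorNorm ℤ : ℕ) : ℤ) (NumberField.discr K) :=
    KolyvaginAssembly.isCoprime_discr_of_satisfiesHeegnerHypothesis hK hHN
  have hD : NumberField.discr K < -4 := by
    have hneg : NumberField.discr K < 0 := hK.discr_neg
    have h3split : SatisfiesHeegnerHypothesis 3 K :=
      SatisfiesHeegnerHypothesis.of_dvd (dvd_conductorNorm_of_mult (W := W) hmult) hHN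
    have hpd : ¬ ((3 : ℕ) : ℤ) ∣ NumberField.discr K :=
      not_dvd_discr_of_split hK Nat.prime_three (by norm_num) h3split
    have hD3 : NumberField.discr K ≠ -3 := fun h ↦ hpd (h ▸ ⟨-1, by norm_num⟩)
    have h4 : NumberField.discr K % 4 = 0 ∨ NumberField.discr K % 4 = 1 :=
      Literature.NumberTheory.QuadraticFields.Quadratic.discr_emod_four (K := K) hK.1
    obtain ⟨r, hr⟩ := hodd
    omega
  -- Gross's one system of choices extending `d`, and Prop. 4.7 for it (from `h44`)
  have hcm : ¬ W.HasCM := not_hasCM_of_hasMultiplicativeReductionAtPrime' W hmult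
  have htower : ∀ j : ℕ, W.HasSurjectiveModNGaloisRep (3 ^ j : ℕ) :=
    forall_hasSurjectiveModNGaloisRep_pow_of_multiplicative_of_surj W 3 (by norm_num) hmult hρ
  obtain ⟨D, hDd, h47⟩ := exists_data_h47Base_of_prop44 h44 W hcm hK hD hHN (p := 3) (by norm_num) htower
    Dt β ι hk hn d
  -- the sign `ε := −w(E)`, a sign function for it, and Gross Prop. 5.3 for the data (from `h53`)
  have hε : (-W.rootNumber : ℤ) = 1 ∨ (-W.rootNumber : ℤ) = -1 := by
    rcases W.rootNumber_eq_one_or with h | h <;> simp [h]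
  obtain ⟨eb, heb, hebε⟩ := Walk.exists_signFunction (-W.rootNumber) hε
  have h53D := h53_of_heegnerPointReflection W (h53 W K) hK hHN (p := 3) Dt β ι (k := k) D
  -- the supply at this frame, for these data and signs
  obtain ⟨𝒯, 𝒮, Qcar, C', hS, hQcar, hdisj, hPT, hselmer, hC, hdual_q, hsel0, hdual_ℓ⟩ :=
    hsupply W K Dt β ι hr hmult hρ hK hHN hodd hLt hβ hc3 τ hτ v k hk h2 n d hn D hDd (-W.rootNumber) hε
      eb heb hebε
  have h49 := h49_of_selmerMembership W hK hND hD (p := 3) (by norm_num) hρ Dt β ι hτ hk 𝒯 𝒮 Qcar D eb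
    (-W.rootNumber) hebε h53D n hsel0
  have hordκ := hordκ_of_admissibleData W hK hND hD (p := 3) (by norm_num) hρ Dt β ι k D
  have hdivfin := fun s ↦ divOrd_ne_top_of_levelIndex_eq_top W K (hrec _ W K) (hGZ _ W K) hmod Dt β ι hr
    hK hHN hLt s (D s)
  have hfin := JET.Walk.hfin_of_kummer (K := K) W Nat.prime_three k 𝒯
  have hκt := hκt_of_selmerMembership W hK hND hD (p := 3) (by norm_num) hρ Dt β ι hτ hk 𝒯 D eb
    (-W.rootNumber) hebε h53D hdivfin hselmer
  have key := tamagawaExponent_le_m_of_orderedFamiliesBase W K hK 3 (by decide) hρ Dt β ι τ hτ k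
    (padicValNat 3 (W.tamagawaNumberAt v)) hk h2 𝒯 𝒮 hS Qcar hQcar D eb heb n hn ?_ ?_ hdisj hfin hPT
    (fun s _ ↦ hκt s) hordκ h47 C' hC hdual_q h49 hdual_ℓ
  · rw [hDd] at key
    exact key
  · rw [hDd]; exact h1
  · rw [hDd]; exact h3

end Summit.BirchSwinnertonDyer.Rank1Residual.X11b.Three.Koly

end
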